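import Literature.NumberTheory.Automorphic.UnitaryGroupArthurTraceEllipticOrbitalTwo
import Literature.NumberTheory.Automorphic.UnitaryGroupQuasiSplitWeilMeasure
import HarnessLib

/-!
# LAW 4 of `U(J₂)` at the Weil measure: `J^T_𝔬(f) = Σ'_{s ⊆ 𝔬} vol · Φ(γ_s, f)` and `J(f) = Σ_{𝔬 ∩ B = ∅} Σ' vol · Φ + Σ_{𝔬 ∩ B ≠ ∅} p_𝔬(0)` — no constant
# (the `N = 2` twin of ★ `UnitaryGroupArthurTraceWeilMeasure`)
(Rogawski, *Automorphic Representations of Unitary Groups in Three Variables* (1990), §2.2–§2.3 pp. 13–14, §7.3 p. 98 and §14.5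
pp. 237–238: `J_𝔬(f) = Σ_γ m(G_γ(F)\G_γ(𝔸)) Φ(γ, f)` for the Weil∕Tamagawa normalisation; Gelbart (1975), (9.13), Remark 9.23;
Deitmar–Echterhoff (2014), Thm. 1.5.3.)

Topic `NumberTheory/Automorphic`; namespace `Literature.NumberTheory.Automorphic.UnitaryGroup`. THEOREMS ONLY (no definition,
no instance, no named fact, no notation, no `sorry`). H-side copy of LAWS 1–5 for the endoscopic group `H = U(Φ₂) × U(Φ₁)` of the line
`Cruxes/H413/Lines/F0_T1InnerFormTraceIdentity.lean` (cell hodgecm-mathlib, crux H413; census `CENSUS-LAWS-Hside` §3 LAW 4, sibling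
`ArthurTraceWeilMeasureTwo`). At the Weil measure `μ = ν/count` on `U(J₂)(L⁺)\U(J₂)(𝔸)` (automorphic by ★
`isAutomorphicMeasure_quotientMeasure_count_quasiSplit_two`, H-B2; Weil's constant `1` by ★
`AdelicGroupData.ofReal_coe_unfoldingConstant_quotientMeasure_eq_one`) the `N = 2` trunk closer ★
`truncatedTraceClass_eq_mul_tsum_covol_mul_orbitalIntegral_cm_two` and the J(f)-level fold ★ `arthurTrace_eq_sum_orbital_add_sum_charpoly_cm_two`
lose their constant. Both heads take the measure through an EQUATION binder `hμ : μ = ν/count` after the colon, so that the instance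
`IsAutomorphicMeasure μ` stays the caller's; for a general automorphic `μ` both sides scale by `c_μ > 0`
(★ `eq_unfoldingConstant_smul_quotientMeasure_count_quasiSplit_cm`, every `N ≥ 2`). Proofs verbatim from the `N = 3` file.
* **`truncatedTraceClass_eq_tsum_covol_mul_orbitalIntegral_of_eq_quotientMeasure_cm_two`** — for every class `𝔬 = cl⁻¹{i}` of a
  conjugation-invariant class map missing `B(L⁺)` and every `T`:
  `J^T_𝔬(f) = Σ'_{s ⊆ 𝔬} vol(G_{γ_s}(L⁺)\G_{γ_s}(𝔸); ν_s) · Φ_{ν/ν_s}(γ_s, f)`;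
* **`arthurTrace_eq_sum_covol_orbital_add_sum_charpoly_of_eq_quotientMeasure_cm_two`** — with the LAW-3 data (`S_f`, `p_𝔬`):
  `J(f) = Σ_{𝔬 ∈ S_f, 𝔬 ∩ B(L⁺) = ∅} Σ'_{s ⊆ 𝔬} vol · Φ_{ν/ν_s}(γ_s, f) + Σ_{𝔬 ∈ S_f, 𝔬 ∩ B(L⁺) ≠ ∅} p_𝔬(0)` for every `T`.
## References
* J. D. Rogawski, *Automorphic Representations of Unitary Groups in Three Variables*, Ann. of Math. Stud. 123 (1990), §2.2–§2.3
  (pp. 13–14), §7.3 (p. 98), §14.5 (pp. 237–238) [Rogawski1990].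
* S. Gelbart, *Automorphic forms on adele groups*, Ann. of Math. Stud. 83 (1975), (9.13), Remark 9.23 [Gelbart1975].
* A. Deitmar, S. Echterhoff, *Principles of Harmonic Analysis*, 2nd ed. (2014), Thm. 1.5.3 [DeitmarEchterhoff2014].
-/

set_option autoImplicit false

noncomputable section

open MeasureTheory Measure NumberField NumberField.mixedEmbedding IsDedekindDomain Set Polynomial Topology
open Literature.MeasureTheory.Group
open scoped NNReal ENNReal Pointwise MatrixGroups Classical

namespace Literature.NumberTheory.Automorphic

namespace UnitaryGroup

variable (L : Type) [Field L] [NumberField L] [IsCMField L]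

/-! ## LAW 4 of `U(J₂)` at the Weil measure: `J^T_𝔬(f) = Σ' vol · Φ`, `J(f) = Σ_{𝔬 ∩ B = ∅} Σ' vol · Φ + Σ_{𝔬 ∩ B ≠ ∅} p_𝔬(0)` — no constant -/

/-- **`J^T_𝔬(f) = Σ'_{s ⊆ 𝔬} vol(G_{γ_s}(L⁺)\G_{γ_s}(𝔸); ν_s) · Φ_{ν/ν_s}(γ_s, f)` at the Weil measure (`U(J₂)`)** — ★
`truncatedTraceClass_eq_mul_tsum_covol_mul_orbitalIntegral_cm_two` for the automorphic measure `μ = ν/count` (equation binder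
`hμ`; the instance `IsAutomorphicMeasure μ` is the caller's, e.g. `isAutomorphicMeasure_quotientMeasure_count_quasiSplit_two`),
where Weil's constant is `1` (★ `unfoldingConstant_quotientMeasure`): the elliptic weights ARE the covolumes, exactly as on the
inner-form side (★ `UnitaryGroupDiagTraceNormalized`). For every class `𝔬 = cl⁻¹{i}` of a conjugation-invariant class map missing
the rational Borel and every `T`. [cite: Rogawski1990, §2.2–2.3 (pp. 13–14)] [cite: Gelbart1975, (9.13) and Remark 9.23] -/
theorem truncatedTraceClass_eq_tsum_covol_mul_orbitalIntegral_of_eq_quotientMeasure_cm_two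
    [instMA : MeasurableSpace (quasiSplit (↥(maximalRealSubfield L)) L (IsCMField.complexConj L) 2).Adelic] [instBA : BorelSpace (quasiSplit (↥(maximalRealSubfield L)) L (IsCMField.complexConj L) 2).Adelic]
    [instMU : MeasurableSpace (adelicUnipotent (↥(maximalRealSubfield L)) L (IsCMField.complexConj L) 2)]
    [instMQ : ∀ γ : (quasiSplit (↥(maximalRealSubfield L)) L (IsCMField.complexConj L) 2).Adelic,
      MeasurableSpace ((quasiSplit (↥(maximalRealSubfield L)) L (IsCMField.complexConj L) 2).Adelic ⧸
        Subgroup.centralizer ({γ} : Set (quasiSplit (↥(maximalRealSubfield L)) L (IsCMField.complexConj L) 2).Adelic))]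
    [instBQ : ∀ γ : (quasiSplit (↥(maximalRealSubfield L)) L (IsCMField.complexConj L) 2).Adelic,
      BorelSpace ((quasiSplit (↥(maximalRealSubfield L)) L (IsCMField.complexConj L) 2).Adelic ⧸
        Subgroup.centralizer ({γ} : Set (quasiSplit (↥(maximalRealSubfield L)) L (IsCMField.complexConj L) 2).Adelic))]
    [instMS : ∀ γ : (quasiSplit (↥(maximalRealSubfield L)) L (IsCMField.complexConj L) 2).Adelic,
      MeasurableSpace (↥(Subgroup.centralizer ({γ} : Set (quasiSplit (↥(maximalRealSubfield L)) L (IsCMField.complexConj L) 2).Adelic)) ⧸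
        ((quasiSplit (↥(maximalRealSubfield L)) L (IsCMField.complexConj L) 2).quotientSubgroup ⊓
          Subgroup.centralizer ({γ} : Set (quasiSplit (↥(maximalRealSubfield L)) L (IsCMField.complexConj L) 2).Adelic)).subgroupOf
          (Subgroup.centralizer ({γ} : Set (quasiSplit (↥(maximalRealSubfield L)) L (IsCMField.complexConj L) 2).Adelic)))]
    [instBS : ∀ γ : (quasiSplit (↥(maximalRealSubfield L)) L (IsCMField.complexConj L) 2).Adelic,
      BorelSpace (↥(Subgroup.centralizer ({γ} : Set (quasiSplit (↥(maximalRealSubfield L)) L (IsCMField.complexConj L) 2).Adelic)) ⧸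
        ((quasiSplit (↥(maximalRealSubfield L)) L (IsCMField.complexConj L) 2).quotientSubgroup ⊓
          Subgroup.centralizer ({γ} : Set (quasiSplit (↥(maximalRealSubfield L)) L (IsCMField.complexConj L) 2).Adelic)).subgroupOf
          (Subgroup.centralizer ({γ} : Set (quasiSplit (↥(maximalRealSubfield L)) L (IsCMField.complexConj L) 2).Adelic)))]
    (μ : Measure (quasiSplit (↥(maximalRealSubfield L)) L (IsCMField.complexConj L) 2).automorphicQuotient)
    [instμ : (quasiSplit (↥(maximalRealSubfield L)) L (IsCMField.complexConj L) 2).IsAutomorphicMeasure μ]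
    (ν : Measure (quasiSplit (↥(maximalRealSubfield L)) L (IsCMField.complexConj L) 2).Adelic) [instν : IsHaarMeasure ν]
    {ι : Type*} {cl : ↥(quasiSplit (↥(maximalRealSubfield L)) L (IsCMField.complexConj L) 2).arithmeticSubgroup → ι}
    (hcl : IsConjInvariant cl) (i : ι)
    (rep : ConjClasses ↥(quasiSplit (↥(maximalRealSubfield L)) L (IsCMField.complexConj L) 2).arithmeticSubgroup → ↥(quasiSplit (↥(maximalRealSubfield L)) L (IsCMField.complexConj L) 2).arithmeticSubgroup)
    (hrep : ∀ s, ConjClasses.mk (rep s) = s)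
    (νC : ∀ s : {s : ConjClasses ↥(quasiSplit (↥(maximalRealSubfield L)) L (IsCMField.complexConj L) 2).arithmeticSubgroup // cl (rep s) = i},
      Measure ↥(Subgroup.centralizer ({((rep s.1 : ↥(quasiSplit (↥(maximalRealSubfield L)) L (IsCMField.complexConj L) 2).arithmeticSubgroup) : (quasiSplit (↥(maximalRealSubfield L)) L (IsCMField.complexConj L) 2).Adelic)} : Set (quasiSplit (↥(maximalRealSubfield L)) L (IsCMField.complexConj L) 2).Adelic)))
    [instνC : ∀ s, IsHaarMeasure (νC s)]
    (hi : ∀ β : arithmeticBorel (↥(maximalRealSubfield L)) L (IsCMField.complexConj L) 2, cl β ≠ i)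
    {f : (quasiSplit (↥(maximalRealSubfield L)) L (IsCMField.complexConj L) 2).Adelic → ℂ}
    (hf : IsQuasiSplitTest (↥(maximalRealSubfield L)) L (IsCMField.complexConj L) 2 f)
    (ν₀ : Measure (adelicUnipotent (↥(maximalRealSubfield L)) L (IsCMField.complexConj L) 2))
    (𝓕 : Set (adelicUnipotent (↥(maximalRealSubfield L)) L (IsCMField.complexConj L) 2)) (T : ℝ≥0) :
    haveI := t2Space_quasiSplitAdelic (F := ↥(maximalRealSubfield L)) (E := L) (c := IsCMField.complexConj L) (N := 2)
    haveI := locallyCompactSpace_quasiSplitAdelic (F := ↥(maximalRealSubfield L)) (E := L) (c := IsCMField.complexConj L) (N := 2)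
    haveI := secondCountableTopology_quasiSplitAdelic (F := ↥(maximalRealSubfield L)) (E := L) (c := IsCMField.complexConj L) (N := 2)
    haveI : IsClosed (((quasiSplit (↥(maximalRealSubfield L)) L (IsCMField.complexConj L) 2).quotientSubgroup : Set (quasiSplit (↥(maximalRealSubfield L)) L (IsCMField.complexConj L) 2).Adelic)) :=
      isClosed_quotientSubgroup_quasiSplit
    haveI : ∀ γ : (quasiSplit (↥(maximalRealSubfield L)) L (IsCMField.complexConj L) 2).Adelic, IsClosed ((Subgroup.centralizer ({γ} : Set (quasiSplit (↥(maximalRealSubfield L)) L (IsCMField.complexConj L) 2).Adelic) :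
        Subgroup (quasiSplit (↥(maximalRealSubfield L)) L (IsCMField.complexConj L) 2).Adelic) : Set (quasiSplit (↥(maximalRealSubfield L)) L (IsCMField.complexConj L) 2).Adelic) := isClosed_centralizer_quasiSplit
    haveI : ∀ γ : (quasiSplit (↥(maximalRealSubfield L)) L (IsCMField.complexConj L) 2).Adelic, (count : Measure ↥(((quasiSplit (↥(maximalRealSubfield L)) L (IsCMField.complexConj L) 2).quotientSubgroup ⊓
        Subgroup.centralizer ({γ} : Set (quasiSplit (↥(maximalRealSubfield L)) L (IsCMField.complexConj L) 2).Adelic)).subgroupOf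
          (Subgroup.centralizer ({γ} : Set (quasiSplit (↥(maximalRealSubfield L)) L (IsCMField.complexConj L) 2).Adelic)))).IsHaarMeasure :=
      isHaarMeasure_count_inf_centralizer_subgroupOf_quasiSplit
    haveI : (count : Measure (quasiSplit (↥(maximalRealSubfield L)) L (IsCMField.complexConj L) 2).quotientSubgroup).IsHaarMeasure :=
      isHaarMeasure_count_quotientSubgroup_quasiSplit
    haveI : ν.IsMulRightInvariant := isMulRightInvariant_quasiSplit_cm_two L ν
    letI := AdelicGroupData.measurableSpaceQuotientForm (quasiSplit (↥(maximalRealSubfield L)) L (IsCMField.complexConj L) 2)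
    haveI := AdelicGroupData.borelSpaceQuotientForm (quasiSplit (↥(maximalRealSubfield L)) L (IsCMField.complexConj L) 2)
    haveI := AdelicGroupData.smulInvariantMeasureQuotientForm (quasiSplit (↥(maximalRealSubfield L)) L (IsCMField.complexConj L) 2) μ
    haveI := AdelicGroupData.isFiniteMeasureOnCompactsQuotientForm (quasiSplit (↥(maximalRealSubfield L)) L (IsCMField.complexConj L) 2) μ
    haveI : ∀ s : {s : ConjClasses ↥(quasiSplit (↥(maximalRealSubfield L)) L (IsCMField.complexConj L) 2).arithmeticSubgroup // cl (rep s) = i},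
        (νC s).IsMulRightInvariant := fun s =>
      isMulRightInvariant_centralizer_of_forall_cl_ne_two hcl hi s.2 (νC s)
    haveI : ∀ s : {s : ConjClasses ↥(quasiSplit (↥(maximalRealSubfield L)) L (IsCMField.complexConj L) 2).arithmeticSubgroup // cl (rep s) = i},
        (νC s).IsInvInvariant := fun s =>
      isInvInvariant_centralizer_of_forall_cl_ne_two hcl hi s.2 (νC s)
    μ = quotientMeasure (quasiSplit (↥(maximalRealSubfield L)) L (IsCMField.complexConj L) 2).quotientSubgroup (count : Measure (quasiSplit (↥(maximalRealSubfield L)) L (IsCMField.complexConj L) 2).quotientSubgroup)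
          (isClosed_quotientSubgroup_quasiSplit (F := ↥(maximalRealSubfield L)) (E := L) (c := IsCMField.complexConj L)) ν →
    truncatedTraceClass μ ν₀ 𝓕 T cl i f =
        ∑' s : {s : ConjClasses ↥(quasiSplit (↥(maximalRealSubfield L)) L (IsCMField.complexConj L) 2).arithmeticSubgroup // cl (rep s) = i},
          ((quotientMeasure (((quasiSplit (↥(maximalRealSubfield L)) L (IsCMField.complexConj L) 2).quotientSubgroup ⊓
                    Subgroup.centralizer ({((rep s.1 : ↥(quasiSplit (↥(maximalRealSubfield L)) L (IsCMField.complexConj L) 2).arithmeticSubgroup) : (quasiSplit (↥(maximalRealSubfield L)) L (IsCMField.complexConj L) 2).Adelic)} : Set (quasiSplit (↥(maximalRealSubfield L)) L (IsCMField.complexConj L) 2).Adelic)).subgroupOf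
                    (Subgroup.centralizer ({((rep s.1 : ↥(quasiSplit (↥(maximalRealSubfield L)) L (IsCMField.complexConj L) 2).arithmeticSubgroup) : (quasiSplit (↥(maximalRealSubfield L)) L (IsCMField.complexConj L) 2).Adelic)} : Set (quasiSplit (↥(maximalRealSubfield L)) L (IsCMField.complexConj L) 2).Adelic)))
                    count (isClosed_inf_centralizer_subgroupOf_quasiSplit _) (νC s) Set.univ).toReal : ℂ) *
                  orbitalIntegral ((rep s.1 : ↥(quasiSplit (↥(maximalRealSubfield L)) L (IsCMField.complexConj L) 2).arithmeticSubgroup) : (quasiSplit (↥(maximalRealSubfield L)) L (IsCMField.complexConj L) 2).Adelic) f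
                    (quotientMeasure (Subgroup.centralizer ({((rep s.1 : ↥(quasiSplit (↥(maximalRealSubfield L)) L (IsCMField.complexConj L) 2).arithmeticSubgroup) : (quasiSplit (↥(maximalRealSubfield L)) L (IsCMField.complexConj L) 2).Adelic)} : Set (quasiSplit (↥(maximalRealSubfield L)) L (IsCMField.complexConj L) 2).Adelic)) (νC s)
                      (isClosed_centralizer_quasiSplit _) ν) := by
  intro hμ
  have h := @truncatedTraceClass_eq_mul_tsum_covol_mul_orbitalIntegral_cm_two L _ _ _ instMA instBA instMU instMQ instBQ instMS
    instBS μ instμ ν instν ι cl hcl i rep hrep νC instνC hi f hf ν₀ 𝓕 T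
  subst hμ
  haveI := t2Space_quasiSplitAdelic (F := ↥(maximalRealSubfield L)) (E := L) (c := IsCMField.complexConj L) (N := 2)
  haveI := locallyCompactSpace_quasiSplitAdelic (F := ↥(maximalRealSubfield L)) (E := L) (c := IsCMField.complexConj L) (N := 2)
  haveI := secondCountableTopology_quasiSplitAdelic (F := ↥(maximalRealSubfield L)) (E := L) (c := IsCMField.complexConj L) (N := 2)
  haveI : (count : Measure (quasiSplit (↥(maximalRealSubfield L)) L (IsCMField.complexConj L) 2).quotientSubgroup).IsHaarMeasure :=
    isHaarMeasure_count_quotientSubgroup_quasiSplit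
  haveI : DiscreteTopology (quasiSplit (↥(maximalRealSubfield L)) L (IsCMField.complexConj L) 2).quotientSubgroup := discreteTopology_quotientSubgroup_quasiSplit
  haveI : ν.IsMulRightInvariant := isMulRightInvariant_quasiSplit_cm_two L ν
  have h1 := AdelicGroupData.ofReal_coe_unfoldingConstant_quotientMeasure_eq_one (quasiSplit (↥(maximalRealSubfield L)) L (IsCMField.complexConj L) 2)
    (isClosed_quotientSubgroup_quasiSplit (F := ↥(maximalRealSubfield L)) (E := L) (c := IsCMField.complexConj L)) count ν
  simp only [h1, one_mul] at h
  exact h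

/-- **`J(f) = Σ_{𝔬 ∈ S_f, 𝔬 ∩ B(L⁺) = ∅} Σ'_{s ⊆ 𝔬} vol(G_{γ_s}(L⁺)\G_{γ_s}(𝔸); ν_s) · Φ_{ν/ν_s}(γ_s, f) + Σ_{𝔬 ∈ S_f, 𝔬 ∩ B(L⁺) ≠ ∅} p_𝔬(0)`
at the Weil measure `μ = ν/count`** — ★ `arthurTrace_eq_sum_orbital_add_sum_charpoly_cm_two` with Weil's constant `1`: the constant
term of Arthur's fine `𝔬`-expansion for `U(J₂)` over a CM field with the PRINTED weights (covolumes) on the elliptic classes, for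
every `T`, together with the LAW-3 data (`S_f`, class polynomials of degree `≤ 1`, their thresholds, their sum = Arthur's polynomial,
constancy off `B(L⁺)`). [cite: Rogawski1990, §2.2–2.3 (pp. 13–14)] [cite: Rogawski1990, §14.5 pp. 237–238]
[cite: Gelbart1975, (9.13) and Remark 9.23] -/
theorem arthurTrace_eq_sum_covol_orbital_add_sum_charpoly_of_eq_quotientMeasure_cm_two
    [instMA : MeasurableSpace (quasiSplit (↥(maximalRealSubfield L)) L (IsCMField.complexConj L) 2).Adelic] [instBA : BorelSpace (quasiSplit (↥(maximalRealSubfield L)) L (IsCMField.complexConj L) 2).Adelic]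
    [instMU : MeasurableSpace (adelicUnipotent (↥(maximalRealSubfield L)) L (IsCMField.complexConj L) 2)]
    [instBU : BorelSpace (adelicUnipotent (↥(maximalRealSubfield L)) L (IsCMField.complexConj L) 2)]
    [instMQ : ∀ γ : (quasiSplit (↥(maximalRealSubfield L)) L (IsCMField.complexConj L) 2).Adelic,
      MeasurableSpace ((quasiSplit (↥(maximalRealSubfield L)) L (IsCMField.complexConj L) 2).Adelic ⧸
        Subgroup.centralizer ({γ} : Set (quasiSplit (↥(maximalRealSubfield L)) L (IsCMField.complexConj L) 2).Adelic))]
    [instBQ : ∀ γ : (quasiSplit (↥(maximalRealSubfield L)) L (IsCMField.complexConj L) 2).Adelic,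
      BorelSpace ((quasiSplit (↥(maximalRealSubfield L)) L (IsCMField.complexConj L) 2).Adelic ⧸
        Subgroup.centralizer ({γ} : Set (quasiSplit (↥(maximalRealSubfield L)) L (IsCMField.complexConj L) 2).Adelic))]
    [instMS : ∀ γ : (quasiSplit (↥(maximalRealSubfield L)) L (IsCMField.complexConj L) 2).Adelic,
      MeasurableSpace (↥(Subgroup.centralizer ({γ} : Set (quasiSplit (↥(maximalRealSubfield L)) L (IsCMField.complexConj L) 2).Adelic)) ⧸
        ((quasiSplit (↥(maximalRealSubfield L)) L (IsCMField.complexConj L) 2).quotientSubgroup ⊓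
          Subgroup.centralizer ({γ} : Set (quasiSplit (↥(maximalRealSubfield L)) L (IsCMField.complexConj L) 2).Adelic)).subgroupOf
          (Subgroup.centralizer ({γ} : Set (quasiSplit (↥(maximalRealSubfield L)) L (IsCMField.complexConj L) 2).Adelic)))]
    [instBS : ∀ γ : (quasiSplit (↥(maximalRealSubfield L)) L (IsCMField.complexConj L) 2).Adelic,
      BorelSpace (↥(Subgroup.centralizer ({γ} : Set (quasiSplit (↥(maximalRealSubfield L)) L (IsCMField.complexConj L) 2).Adelic)) ⧸
        ((quasiSplit (↥(maximalRealSubfield L)) L (IsCMField.complexConj L) 2).quotientSubgroup ⊓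
          Subgroup.centralizer ({γ} : Set (quasiSplit (↥(maximalRealSubfield L)) L (IsCMField.complexConj L) 2).Adelic)).subgroupOf
          (Subgroup.centralizer ({γ} : Set (quasiSplit (↥(maximalRealSubfield L)) L (IsCMField.complexConj L) 2).Adelic)))]
    (ν₀ : Measure (adelicUnipotent (↥(maximalRealSubfield L)) L (IsCMField.complexConj L) 2)) [instν₀ : ν₀.IsHaarMeasure]
    (𝓕 : Set (adelicUnipotent (↥(maximalRealSubfield L)) L (IsCMField.complexConj L) 2))
    (h𝓕 : IsFundamentalDomain (rationalUnipotent (↥(maximalRealSubfield L)) L (IsCMField.complexConj L) 2) 𝓕 ν₀)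
    (μ : Measure (quasiSplit (↥(maximalRealSubfield L)) L (IsCMField.complexConj L) 2).automorphicQuotient)
    [instμ : (quasiSplit (↥(maximalRealSubfield L)) L (IsCMField.complexConj L) 2).IsAutomorphicMeasure μ]
    (ν : Measure (quasiSplit (↥(maximalRealSubfield L)) L (IsCMField.complexConj L) 2).Adelic) [instν : IsHaarMeasure ν]
    (rep : ConjClasses ↥(quasiSplit (↥(maximalRealSubfield L)) L (IsCMField.complexConj L) 2).arithmeticSubgroup → ↥(quasiSplit (↥(maximalRealSubfield L)) L (IsCMField.complexConj L) 2).arithmeticSubgroup)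
    (hrep : ∀ s, ConjClasses.mk (rep s) = s)
    (νC : ∀ s : ConjClasses ↥(quasiSplit (↥(maximalRealSubfield L)) L (IsCMField.complexConj L) 2).arithmeticSubgroup,
      Measure ↥(Subgroup.centralizer ({((rep s : ↥(quasiSplit (↥(maximalRealSubfield L)) L (IsCMField.complexConj L) 2).arithmeticSubgroup) : (quasiSplit (↥(maximalRealSubfield L)) L (IsCMField.complexConj L) 2).Adelic)} : Set (quasiSplit (↥(maximalRealSubfield L)) L (IsCMField.complexConj L) 2).Adelic)))
    [instνC : ∀ s, IsHaarMeasure (νC s)]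
    (f : (quasiSplit (↥(maximalRealSubfield L)) L (IsCMField.complexConj L) 2).Adelic → ℂ)
    (hf : IsQuasiSplitTest (↥(maximalRealSubfield L)) L (IsCMField.complexConj L) 2 f) :
    haveI := t2Space_quasiSplitAdelic (F := ↥(maximalRealSubfield L)) (E := L) (c := IsCMField.complexConj L) (N := 2)
    haveI := locallyCompactSpace_quasiSplitAdelic (F := ↥(maximalRealSubfield L)) (E := L) (c := IsCMField.complexConj L) (N := 2)
    haveI := secondCountableTopology_quasiSplitAdelic (F := ↥(maximalRealSubfield L)) (E := L) (c := IsCMField.complexConj L) (N := 2)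
    haveI : IsClosed (((quasiSplit (↥(maximalRealSubfield L)) L (IsCMField.complexConj L) 2).quotientSubgroup : Set (quasiSplit (↥(maximalRealSubfield L)) L (IsCMField.complexConj L) 2).Adelic)) :=
      isClosed_quotientSubgroup_quasiSplit
    haveI : ∀ γ : (quasiSplit (↥(maximalRealSubfield L)) L (IsCMField.complexConj L) 2).Adelic, IsClosed ((Subgroup.centralizer ({γ} : Set (quasiSplit (↥(maximalRealSubfield L)) L (IsCMField.complexConj L) 2).Adelic) :
        Subgroup (quasiSplit (↥(maximalRealSubfield L)) L (IsCMField.complexConj L) 2).Adelic) : Set (quasiSplit (↥(maximalRealSubfield L)) L (IsCMField.complexConj L) 2).Adelic) := isClosed_centralizer_quasiSplit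
    haveI : ∀ γ : (quasiSplit (↥(maximalRealSubfield L)) L (IsCMField.complexConj L) 2).Adelic, (count : Measure ↥(((quasiSplit (↥(maximalRealSubfield L)) L (IsCMField.complexConj L) 2).quotientSubgroup ⊓
        Subgroup.centralizer ({γ} : Set (quasiSplit (↥(maximalRealSubfield L)) L (IsCMField.complexConj L) 2).Adelic)).subgroupOf
          (Subgroup.centralizer ({γ} : Set (quasiSplit (↥(maximalRealSubfield L)) L (IsCMField.complexConj L) 2).Adelic)))).IsHaarMeasure :=
      isHaarMeasure_count_inf_centralizer_subgroupOf_quasiSplit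
    haveI : (count : Measure (quasiSplit (↥(maximalRealSubfield L)) L (IsCMField.complexConj L) 2).quotientSubgroup).IsHaarMeasure :=
      isHaarMeasure_count_quotientSubgroup_quasiSplit
    haveI : ν.IsMulRightInvariant := isMulRightInvariant_quasiSplit_cm_two L ν
    letI := AdelicGroupData.measurableSpaceQuotientForm (quasiSplit (↥(maximalRealSubfield L)) L (IsCMField.complexConj L) 2)
    haveI := AdelicGroupData.borelSpaceQuotientForm (quasiSplit (↥(maximalRealSubfield L)) L (IsCMField.complexConj L) 2)
    haveI := AdelicGroupData.smulInvariantMeasureQuotientForm (quasiSplit (↥(maximalRealSubfield L)) L (IsCMField.complexConj L) 2) μ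
    haveI := AdelicGroupData.isFiniteMeasureOnCompactsQuotientForm (quasiSplit (↥(maximalRealSubfield L)) L (IsCMField.complexConj L) 2) μ
    μ = quotientMeasure (quasiSplit (↥(maximalRealSubfield L)) L (IsCMField.complexConj L) 2).quotientSubgroup (count : Measure (quasiSplit (↥(maximalRealSubfield L)) L (IsCMField.complexConj L) 2).quotientSubgroup)
          (isClosed_quotientSubgroup_quasiSplit (F := ↥(maximalRealSubfield L)) (E := L) (c := IsCMField.complexConj L)) ν →
    ∃ S : Finset (AdeleRing (𝓞 L) L)[X], ∃ P : (AdeleRing (𝓞 L) L)[X] → ℂ[X],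
      (∀ i, (P i).natDegree ≤ 1) ∧
      (∀ i ∈ S, ∃ T₀ : ℝ≥0, ∀ T : ℝ≥0, T₀ < T → truncatedTraceClass μ ν₀ 𝓕 T
          (fun γ : ↥(quasiSplit (↥(maximalRealSubfield L)) L (IsCMField.complexConj L) 2).arithmeticSubgroup =>
                  ((adelicVal (↥(maximalRealSubfield L)) L (IsCMField.complexConj L) 2 _ (γ : (quasiSplit (↥(maximalRealSubfield L)) L (IsCMField.complexConj L) 2).Adelic) :
                    GL (Fin 2) (AdeleRing (𝓞 L) L)) : Matrix (Fin 2) (Fin 2) (AdeleRing (𝓞 L) L)).charpoly) i f =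
            (P i).eval ((Real.log (T : ℝ) : ℝ) : ℂ)) ∧
      truncatedTracePolynomial μ ν₀ 𝓕 f = ∑ i ∈ S, P i ∧
      (∀ i ∈ S, (∀ β : arithmeticBorel (↥(maximalRealSubfield L)) L (IsCMField.complexConj L) 2,
          (fun γ : ↥(quasiSplit (↥(maximalRealSubfield L)) L (IsCMField.complexConj L) 2).arithmeticSubgroup =>
                  ((adelicVal (↥(maximalRealSubfield L)) L (IsCMField.complexConj L) 2 _ (γ : (quasiSplit (↥(maximalRealSubfield L)) L (IsCMField.complexConj L) 2).Adelic) :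
                    GL (Fin 2) (AdeleRing (𝓞 L) L)) : Matrix (Fin 2) (Fin 2) (AdeleRing (𝓞 L) L)).charpoly) β ≠ i) →
        ∀ T : ℝ≥0, P i = C (truncatedTraceClass μ ν₀ 𝓕 T
          (fun γ : ↥(quasiSplit (↥(maximalRealSubfield L)) L (IsCMField.complexConj L) 2).arithmeticSubgroup =>
                  ((adelicVal (↥(maximalRealSubfield L)) L (IsCMField.complexConj L) 2 _ (γ : (quasiSplit (↥(maximalRealSubfield L)) L (IsCMField.complexConj L) 2).Adelic) :
                    GL (Fin 2) (AdeleRing (𝓞 L) L)) : Matrix (Fin 2) (Fin 2) (AdeleRing (𝓞 L) L)).charpoly) i f)) ∧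
      ∀ T : ℝ≥0, arthurTrace μ ν₀ 𝓕 f =
        (∑ i ∈ (S.filter (fun i => ∀ β : arithmeticBorel (↥(maximalRealSubfield L)) L (IsCMField.complexConj L) 2,
                (fun γ : ↥(quasiSplit (↥(maximalRealSubfield L)) L (IsCMField.complexConj L) 2).arithmeticSubgroup =>
                  ((adelicVal (↥(maximalRealSubfield L)) L (IsCMField.complexConj L) 2 _ (γ : (quasiSplit (↥(maximalRealSubfield L)) L (IsCMField.complexConj L) 2).Adelic) :
                    GL (Fin 2) (AdeleRing (𝓞 L) L)) : Matrix (Fin 2) (Fin 2) (AdeleRing (𝓞 L) L)).charpoly) β ≠ i)).attach,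
            ∑' s : {s : ConjClasses ↥(quasiSplit (↥(maximalRealSubfield L)) L (IsCMField.complexConj L) 2).arithmeticSubgroup //
                (fun γ : ↥(quasiSplit (↥(maximalRealSubfield L)) L (IsCMField.complexConj L) 2).arithmeticSubgroup =>
                  ((adelicVal (↥(maximalRealSubfield L)) L (IsCMField.complexConj L) 2 _ (γ : (quasiSplit (↥(maximalRealSubfield L)) L (IsCMField.complexConj L) 2).Adelic) :
                    GL (Fin 2) (AdeleRing (𝓞 L) L)) : Matrix (Fin 2) (Fin 2) (AdeleRing (𝓞 L) L)).charpoly) (rep s) = i.1},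
              (haveI : (νC s.1).IsMulRightInvariant :=
                  isMulRightInvariant_centralizer_of_forall_cl_ne_two
                    isConjInvariant_charpoly_adelicVal (Finset.mem_filter.1 i.2).2 s.2 (νC s.1);
                haveI : (νC s.1).IsInvInvariant :=
                  isInvInvariant_centralizer_of_forall_cl_ne_two
                    isConjInvariant_charpoly_adelicVal (Finset.mem_filter.1 i.2).2 s.2 (νC s.1);
                ((quotientMeasure (((quasiSplit (↥(maximalRealSubfield L)) L (IsCMField.complexConj L) 2).quotientSubgroup ⊓
                    Subgroup.centralizer ({((rep s.1 : ↥(quasiSplit (↥(maximalRealSubfield L)) L (IsCMField.complexConj L) 2).arithmeticSubgroup) : (quasiSplit (↥(maximalRealSubfield L)) L (IsCMField.complexConj L) 2).Adelic)} : Set (quasiSplit (↥(maximalRealSubfield L)) L (IsCMField.complexConj L) 2).Adelic)).subgroupOf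
                    (Subgroup.centralizer ({((rep s.1 : ↥(quasiSplit (↥(maximalRealSubfield L)) L (IsCMField.complexConj L) 2).arithmeticSubgroup) : (quasiSplit (↥(maximalRealSubfield L)) L (IsCMField.complexConj L) 2).Adelic)} : Set (quasiSplit (↥(maximalRealSubfield L)) L (IsCMField.complexConj L) 2).Adelic)))
                    count (isClosed_inf_centralizer_subgroupOf_quasiSplit _) (νC s.1) Set.univ).toReal : ℂ) *
                  orbitalIntegral ((rep s.1 : ↥(quasiSplit (↥(maximalRealSubfield L)) L (IsCMField.complexConj L) 2).arithmeticSubgroup) : (quasiSplit (↥(maximalRealSubfield L)) L (IsCMField.complexConj L) 2).Adelic) f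
                    (quotientMeasure (Subgroup.centralizer ({((rep s.1 : ↥(quasiSplit (↥(maximalRealSubfield L)) L (IsCMField.complexConj L) 2).arithmeticSubgroup) : (quasiSplit (↥(maximalRealSubfield L)) L (IsCMField.complexConj L) 2).Adelic)} : Set (quasiSplit (↥(maximalRealSubfield L)) L (IsCMField.complexConj L) 2).Adelic)) (νC s.1)
                      (isClosed_centralizer_quasiSplit _) ν))) +
        ∑ i ∈ S.filter (fun i => ¬ ∀ β : arithmeticBorel (↥(maximalRealSubfield L)) L (IsCMField.complexConj L) 2,
                (fun γ : ↥(quasiSplit (↥(maximalRealSubfield L)) L (IsCMField.complexConj L) 2).arithmeticSubgroup =>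
                  ((adelicVal (↥(maximalRealSubfield L)) L (IsCMField.complexConj L) 2 _ (γ : (quasiSplit (↥(maximalRealSubfield L)) L (IsCMField.complexConj L) 2).Adelic) :
                    GL (Fin 2) (AdeleRing (𝓞 L) L)) : Matrix (Fin 2) (Fin 2) (AdeleRing (𝓞 L) L)).charpoly) β ≠ i),
          (P i).eval 0 := by
  intro hμ
  have hfold := @arthurTrace_eq_sum_orbital_add_sum_charpoly_cm_two L _ _ _ instMA instBA instMU instBU instMQ instBQ instMS instBS ν₀
    instν₀ 𝓕 h𝓕 μ instμ ν instν rep hrep νC instνC f hf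
  obtain ⟨S, P, hdeg, hP, hpoly, hC, hJ⟩ := hfold
  subst hμ
  haveI := t2Space_quasiSplitAdelic (F := ↥(maximalRealSubfield L)) (E := L) (c := IsCMField.complexConj L) (N := 2)
  haveI := locallyCompactSpace_quasiSplitAdelic (F := ↥(maximalRealSubfield L)) (E := L) (c := IsCMField.complexConj L) (N := 2)
  haveI := secondCountableTopology_quasiSplitAdelic (F := ↥(maximalRealSubfield L)) (E := L) (c := IsCMField.complexConj L) (N := 2)
  haveI : (count : Measure (quasiSplit (↥(maximalRealSubfield L)) L (IsCMField.complexConj L) 2).quotientSubgroup).IsHaarMeasure :=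
    isHaarMeasure_count_quotientSubgroup_quasiSplit
  haveI : DiscreteTopology (quasiSplit (↥(maximalRealSubfield L)) L (IsCMField.complexConj L) 2).quotientSubgroup := discreteTopology_quotientSubgroup_quasiSplit
  haveI : ν.IsMulRightInvariant := isMulRightInvariant_quasiSplit_cm_two L ν
  have h1 := AdelicGroupData.ofReal_coe_unfoldingConstant_quotientMeasure_eq_one (quasiSplit (↥(maximalRealSubfield L)) L (IsCMField.complexConj L) 2)
    (isClosed_quotientSubgroup_quasiSplit (F := ↥(maximalRealSubfield L)) (E := L) (c := IsCMField.complexConj L)) count ν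
  refine ⟨S, P, hdeg, hP, hpoly, hC, fun T => (hJ T).trans ?_⟩
  simp only [h1, one_mul]

end UnitaryGroup

end Literature.NumberTheory.Automorphic
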